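import Summits.KontsevichZagierPeriods.KontsevichZagierPeriods.Theses.HurwitzMicroSectors
import Summits.KontsevichZagierPeriods.KontsevichZagierPeriods.Theorems.HurwitzMicroSectorsNormalFormPrinciplePiBoxTransfer
import Summits.KontsevichZagierPeriods.KontsevichZagierPeriods.Theorems.HurwitzMicroSectorsNormalFormPrincipleVariants2238
import Summits.KontsevichZagierPeriods.KontsevichZagierPeriods.Theorems.HurwitzMicroSectorsNormalFormPrincipleVariants2227

/-! TTRL-lite variant V2295 of stmt-KontsevichZagierPeriods-3869

Variant V2295 = `stub_boxRigidity` (the leaf `BoxRigidity` of `NormalFormPrinciple`: two representations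
on open unit boxes with integrands of KZ's rational shape `p/q`, `q ≠ 0` on the box, and equal values are
KZ-equivalent) under the two-sided move `fix_nat:m=5; fix_nat:m'=6` (left dimension frozen to `5`, right
dimension to `6`). Verdict of the attempt seat: **open** — this file is the exact-strength certificate,
not a proof of the variant. With `BoxVanishing K` := "every box-rational representation of dimension `K`
and value `0` is a relation", a pair of FROZEN dimensions `(K, k)` is exactly `BoxVanishing (max K k)`
(`boxRigidityPair_iff_boxVanishingDim_right`, file `…Variants2227`, packaging
`boxVanishingDim_right_of_pair` — compare with the zero representation on the `5`-box — and
`boxRigidityLe_of_boxVanishingDim` — pad both representations to `(0,1)⁶` by `pad_le` and subtract there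
by `sub_same`, value `0` by soundness — of `…Variants2238`). Hence
`V2295 ⟺ BoxVanishing 6 ⟺ BoxRigidity for all m, m' ≤ 6 ⟺ V2227` (`fix_nat:m=2; fix_nat:m'=6`)
(`stub_boxRigidity_var2295_iff_boxVanishing_six`, `…_iff_le_six`, `…_iff_var2227`), and V2295 gives
`BoxVanishing j` for every `j ≤ 6` (`boxVanishing_le_six_of_stub_boxRigidity_var2295`). Why open:
`BoxVanishing 1` is a theorem of the tree (`boxRigidity_of_le_one`, Baker), but already `BoxVanishing 2`
contains, for every `c : ℚ`, "`G = c ⇒ [(0,1)², 1/(1+x²y²) − c]` is a relation" (`G` Catalan's constant;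
the side conditions of the four moves do not see the value, a chain at `c` proves `G = c` by soundness, so
a proof must refute `G = c` for all but at most one explicit rational `c` — an irrationality-type theorem,
open), and `BoxVanishing 5 ∋` the same dichotomy for `ζ(5) = ∫_{(0,1)⁵} dx/(1 − x₁⋯x₅)`. Conversely
`KontsevichZagierPeriods ⟹ parent ⟹ V2295` (`stub_boxRigidity_var2295_of_statement`), so a refutation of
the variant would refute the Summit (Conjecture 1 for the tree's calculus), and the tree has no invariant
of `KZ.relations` finer than `eval`. Residual goal: `BoxVanishing 6`.
Source: M. Kontsevich, D. Zagier, *Periods* (2001), §1.2 Conjecture 1. Pure proof file, no definitions. -/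

-- `Summit.<Summit>.<Problem>` is the tree's mandated summit-side namespace (CONVENTIONS §2); for this
-- single-conjunct summit the two coincide, so the duplicate is deliberate.
set_option linter.dupNamespace false

noncomputable section

namespace Summit.KontsevichZagierPeriods.KontsevichZagierPeriods.Theorems

open MeasureTheory Set
open Literature.NumberTheory.Transcendental Literature.NumberTheory.Transcendental.KZ
open Summit.KontsevichZagierPeriods.KontsevichZagierPeriods.Theses.HurwitzMicroSectors
open Summit.KontsevichZagierPeriods.HurwitzMicroSectors.NormalFormPrinciple.PiBox

/-! ## The variant V2295 is exactly `BoxVanishing 6` -/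

/-- **V2295 ⟺ `BoxVanishing 6`** (instance `K = 5 ≤ 6 = k` of
`boxRigidityPair_iff_boxVanishingDim_right`: compare a vanishing box-rational `M : IntegralRep 6` with the
zero representation on `(0,1)⁵` one way; pad `N` to `(0,1)⁶` and subtract the other way).
[cite: KontsevichZagier2001, §1.2 Conjecture 1] -/
theorem stub_boxRigidity_var2295_iff_boxVanishing_six :
    (∀ (N : IntegralRep 5) (N' : IntegralRep 6), N.domain = {x | ∀ i, x i ∈ Set.Ioo (0:ℝ) 1} → N.IsRational → N'.domain = {x | ∀ i, x i ∈ Set.Ioo (0:ℝ) 1} → N'.IsRational → N.value = N'.value → Equivalent N N') ↔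
    (∀ (M : IntegralRep 6), M.domain = {x | ∀ i, x i ∈ Set.Ioo (0:ℝ) 1} → M.IsRational →
      M.value = 0 → of M ∈ relations) :=
  boxRigidityPair_iff_boxVanishingDim_right (by norm_num)

/-- **V2295 ⟺ `BoxRigidity` for all `m, m' ≤ 6`** (the honest strength of the variant: Conjecture 1
for all pairs of rational integrands on the open unit boxes of dimension at most `6`; freezing the pair
of dimensions to `(5, 6)` loses nothing against the joint bound, by padding).
[cite: KontsevichZagier2001, §1.2 Conjecture 1] -/
theorem stub_boxRigidity_var2295_iff_le_six :
    (∀ (N : IntegralRep 5) (N' : IntegralRep 6), N.domain = {x | ∀ i, x i ∈ Set.Ioo (0:ℝ) 1} → N.IsRational → N'.domain = {x | ∀ i, x i ∈ Set.Ioo (0:ℝ) 1} → N'.IsRational → N.value = N'.value → Equivalent N N') ↔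
    (∀ (m m' : ℕ) (N : IntegralRep m) (N' : IntegralRep m'), m ≤ 6 → m' ≤ 6 →
      N.domain = {x | ∀ i, x i ∈ Set.Ioo (0:ℝ) 1} → N.IsRational →
      N'.domain = {x | ∀ i, x i ∈ Set.Ioo (0:ℝ) 1} → N'.IsRational →
      N.value = N'.value → Equivalent N N') := by
  rw [stub_boxRigidity_var2295_iff_boxVanishing_six]
  exact ⟨fun hvan => boxRigidityLe_of_boxVanishingDim 6 hvan,
    fun h => boxVanishingDim_left_of_pair 6 6 fun N N' => h 6 6 N N' le_rfl le_rfl⟩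

/-- **V2295 ⟺ the sibling V2227** (`fix_nat:m=2; fix_nat:m'=6`): both are `BoxVanishing 6`
(`stub_boxRigidity_var2227_iff_boxVanishing_six`, file `…Variants2227`).
[cite: KontsevichZagier2001, §1.2 Conjecture 1] -/
theorem stub_boxRigidity_var2295_iff_var2227 :
    (∀ (N : IntegralRep 5) (N' : IntegralRep 6), N.domain = {x | ∀ i, x i ∈ Set.Ioo (0:ℝ) 1} → N.IsRational → N'.domain = {x | ∀ i, x i ∈ Set.Ioo (0:ℝ) 1} → N'.IsRational → N.value = N'.value → Equivalent N N') ↔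
    (∀ (N : IntegralRep 2) (N' : IntegralRep 6), N.domain = {x | ∀ i, x i ∈ Set.Ioo (0:ℝ) 1} → N.IsRational → N'.domain = {x | ∀ i, x i ∈ Set.Ioo (0:ℝ) 1} → N'.IsRational → N.value = N'.value → Equivalent N N') :=
  stub_boxRigidity_var2295_iff_boxVanishing_six.trans stub_boxRigidity_var2227_iff_boxVanishing_six.symm

/-- **V2295 with the dimensions swapped** (`(6, 5)` instead of `(5, 6)`) is the same statement, by the
symmetry of `Equivalent` (`boxRigidityPair_comm`). [cite: KontsevichZagier2001, §1.2 Conjecture 1] -/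
theorem stub_boxRigidity_var2295_iff_swap :
    (∀ (N : IntegralRep 5) (N' : IntegralRep 6), N.domain = {x | ∀ i, x i ∈ Set.Ioo (0:ℝ) 1} → N.IsRational → N'.domain = {x | ∀ i, x i ∈ Set.Ioo (0:ℝ) 1} → N'.IsRational → N.value = N'.value → Equivalent N N') ↔
    (∀ (N : IntegralRep 6) (N' : IntegralRep 5), N.domain = {x | ∀ i, x i ∈ Set.Ioo (0:ℝ) 1} → N.IsRational → N'.domain = {x | ∀ i, x i ∈ Set.Ioo (0:ℝ) 1} → N'.IsRational → N.value = N'.value → Equivalent N N') :=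
  boxRigidityPair_comm 5 6

/-- **V2295 ⇒ `BoxVanishing` in every dimension `≤ 6`** (monotonicity by padding,
`boxVanishingDim_mono`): in particular the dimension-`5` statement containing the `ζ(5)` dichotomy and
the dimension-`2` statement containing Catalan's. [cite: KontsevichZagier2001, §1.2 Conjecture 1] -/
theorem boxVanishing_le_six_of_stub_boxRigidity_var2295
    (h : ∀ (N : IntegralRep 5) (N' : IntegralRep 6), N.domain = {x | ∀ i, x i ∈ Set.Ioo (0:ℝ) 1} → N.IsRational → N'.domain = {x | ∀ i, x i ∈ Set.Ioo (0:ℝ) 1} → N'.IsRational → N.value = N'.value → Equivalent N N')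
    {j : ℕ} (hj : j ≤ 6) (N : IntegralRep j) (hNd : N.domain = {x | ∀ i, x i ∈ Set.Ioo (0:ℝ) 1})
    (hNr : N.IsRational) (hv : N.value = 0) : of N ∈ relations :=
  boxVanishingDim_mono hj (stub_boxRigidity_var2295_iff_boxVanishing_six.1 h) N hNd hNr hv

/-! ## Upper bounds: the parent leaf and the Summit imply V2295 -/

/-- **The parent leaf ⇒ V2295** (specialisation `m := 5`, `m' := 6`; the converse is not claimed — the
parent is `BoxVanishing` in ALL dimensions). [cite: KontsevichZagier2001, §1.2 Conjecture 1] -/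
theorem stub_boxRigidity_var2295_of_parent
    (h : ∀ (m m' : ℕ) (N : IntegralRep m) (N' : IntegralRep m'), N.domain = {x | ∀ i, x i ∈ Set.Ioo (0:ℝ) 1} → N.IsRational → N'.domain = {x | ∀ i, x i ∈ Set.Ioo (0:ℝ) 1} → N'.IsRational → N.value = N'.value → Equivalent N N') :
    ∀ (N : IntegralRep 5) (N' : IntegralRep 6), N.domain = {x | ∀ i, x i ∈ Set.Ioo (0:ℝ) 1} → N.IsRational → N'.domain = {x | ∀ i, x i ∈ Set.Ioo (0:ℝ) 1} → N'.IsRational → N.value = N'.value → Equivalent N N' :=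
  h 5 6

/-- **`KontsevichZagierPeriods ⇒ V2295`**: the variant is a special case of Conjecture 1 for the tree's
calculus (`leaves_of_statement`) — so a refutation of the variant would refute the Summit.
[cite: KontsevichZagier2001, §1.2 Conjecture 1] -/
theorem stub_boxRigidity_var2295_of_statement (h : _root_.KontsevichZagierPeriods) :
    ∀ (N : IntegralRep 5) (N' : IntegralRep 6), N.domain = {x | ∀ i, x i ∈ Set.Ioo (0:ℝ) 1} → N.IsRational → N'.domain = {x | ∀ i, x i ∈ Set.Ioo (0:ℝ) 1} → N'.IsRational → N.value = N'.value → Equivalent N N' :=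
  stub_boxRigidity_var2295_of_parent (leaves_of_statement h).1

end Summit.KontsevichZagierPeriods.KontsevichZagierPeriods.Theorems

end
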